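import Literature.Probability.RandomPlanarGeometry.SAWKestenBridgeMeasure
import Mathlib.Analysis.SpecificLimits.Normed
import HarnessLib

/-!
# Kesten's infinite bridge: polynomial cylinder density ⇒ summable rare-prefix probabilities (lane «pcv-sawmu», R45.2 «INF-BRIDGE»)

Topic `Literature/Probability/RandomPlanarGeometry` (continues `SAWKestenBridgeMeasure.lean`: `Zd.kestenCyl d m q`, Kesten's
infinite-bridge cylinder weights `Σ_k |E_k(q)| μ^{-k}` of Madras–Slade (8.3.4)/(8.3.6)).

Source: N. Madras, G. Slade, *The Self-Avoiding Walk* (1993), §8.3 (Kesten's measure `P^B_∞`, Theorem 8.3.1). Lane «pcv-sawmu»,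
a-idea-1 `Sketch_G9.lean` §R45: the planner's Props `IrrPrefixPoly C a` (crux: polynomial cylinder density) and `KestenTransfer`
(every exponentially `μ`-rare prefix property has summable `P^B_∞`-probability) — the former declared VERBATIM, the latter kept as
the verbatim CONCLUSION of the routine transfer R45.2 `summable_kestenCyl_of_irrPrefixPoly : IrrPrefixPoly C a → (KestenTransfer body)`
(`Σ_m K θ^m · C m^a μ^{-m} < ∞`), so that no unproved named `Prop` enters the tree.
Tree-twin search: stems `IrrPrefix`, `KestenTransfer`, `kestenCyl.*summable` → none. No twin.
-/

noncomputable section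

open Finset Filter Topology Literature.Probability.LatticeModels Literature.Probability.Percolation
open scoped BigOperators

namespace Literature.Probability.RandomPlanarGeometry.SAW.Zd

/-- **IRR-PREFIX(C,a)** (crux, rank 2): Kesten's measure `P^B_∞` on `ℤ²` has density at most `C m^a` against
`μ^{-m} ×` counting measure on `m`-step cylinders: `P^B_∞(ω[0,m] = q) ≤ C m^a μ^{-m}` for every `m`-step SAW `q`.
OPEN HYPOTHESIS (the lane's crux IRR-PREFIX, planner's statement a-idea-1 `Sketch_G9.lean` §R45, verbatim; NOT a printed result;
heuristic average density `m^{-11/32}`); the cite locates the OBJECTS (Kesten's measure, Theorem 8.3.1; cylinder weights (8.3.4)/(8.3.6)).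
[cite: MadrasSlade1993, §8.3, Theorem 8.3.1 and eq. (8.3.6)] -/
def IrrPrefixPoly (C a : ℝ) : Prop :=
  ∀ m : ℕ, 1 ≤ m → ∀ q ∈ saws 2 m, kestenCyl 2 m q ≤ C * (m : ℝ) ^ a * (connectiveConstant 2 ^ m)⁻¹

/- The planner's transfer TARGET `KestenTransfer : Prop` (Sketch_G9 §R45) is NOT declared here as a named `Prop` (it would be
an unproved named fact of the tree); instead `summable_kestenCyl_of_irrPrefixPoly` below concludes its BODY verbatim. -/

/-- `kestenCyl ≥ 0`. [cite: MadrasSlade1993, §8.3, eq. (8.3.6)] -/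
theorem kestenCyl_nonneg' (m : ℕ) (q : ℕ → Site 2) : 0 ≤ kestenCyl 2 m q := by
  rw [kestenCyl_eq_tsum_div]
  exact tsum_nonneg fun k => div_nonneg (Nat.cast_nonneg _) (pow_nonneg (connectiveConstant_pos 2).le _)

/-- **R45.2 — IRR-PREFIX ⇒ transfer** (`Σ_m K θ^m · C m^a μ^{-m} < ∞` since `θ < μ`): under `IrrPrefixPoly C a`, every
exponentially `μ`-rare prefix property `A` (`#A_m ≤ K θ^m`, `θ < μ`) has summable Kesten cylinder mass
`Σ_m Σ_{q ∈ A_{m+1}} P^B_∞(q)` (the conclusion is the body of the planner's `KestenTransfer`, verbatim).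
[cite: MadrasSlade1993, §8.3, Theorem 8.3.1 (Kesten's measure); elementary summability] -/
theorem summable_kestenCyl_of_irrPrefixPoly {C a : ℝ} (h : IrrPrefixPoly C a) :
    ∀ A : ℕ → Finset (ℕ → Site 2), (∀ m, A m ⊆ saws 2 m) →
      (∃ θ K : ℝ, 0 < θ ∧ θ < connectiveConstant 2 ∧ ∀ m, ((A m).card : ℝ) ≤ K * θ ^ m) →
        Summable (fun m => ∑ q ∈ A (m + 1), kestenCyl 2 (m + 1) q) := by
  intro A hA hrare
  obtain ⟨θ, K, hθ0, hθμ, hcard⟩ := hrare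
  have hμ : 0 < connectiveConstant 2 := connectiveConstant_pos 2
  set r : ℝ := θ / connectiveConstant 2 with hr
  have hr0 : 0 < r := div_pos hθ0 hμ
  have hr1 : r < 1 := (div_lt_one hμ).2 hθμ
  have hK : 0 ≤ K := by
    have := hcard 0
    have h0 : (0 : ℝ) ≤ ((A 0).card : ℝ) := Nat.cast_nonneg _
    nlinarith [pow_nonneg hθ0.le 0]
  -- `C ≥ 0` unless some `saws 2 m` is empty (it never is); we only need the bound where `A (m+1)` is non-empty
  -- the dominating series: `K C (m+1)^⌈a⌉₊ r^(m+1)` (with `(m+1)^a ≤ (m+1)^⌈a⌉₊` as `m + 1 ≥ 1`)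
  set N := ⌈max a 0⌉₊ with hN
  have hdom : Summable fun m : ℕ => |K * C| * (((m + 1 : ℕ) : ℝ) ^ N * r ^ (m + 1)) := by
    have hs := summable_pow_mul_geometric_of_norm_lt_one N (show ‖r‖ < 1 by rw [Real.norm_eq_abs, abs_of_pos hr0]; exact hr1)
    have hs' : Summable fun m : ℕ => (((m + 1 : ℕ) : ℝ) ^ N * r ^ (m + 1)) :=
      (summable_nat_add_iff 1).2 hs
    exact hs'.mul_left _
  refine Summable.of_nonneg_of_le (fun m => Finset.sum_nonneg fun q _ => kestenCyl_nonneg' _ _) (fun m => ?_) hdom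
  -- the bound for one `m`
  have hm1 : 1 ≤ m + 1 := by omega
  have hpow_a : ((m + 1 : ℕ) : ℝ) ^ a ≤ ((m + 1 : ℕ) : ℝ) ^ (N : ℝ) := by
    have h1 : (1 : ℝ) ≤ ((m + 1 : ℕ) : ℝ) := by exact_mod_cast hm1
    exact Real.rpow_le_rpow_of_exponent_le h1 ((le_max_left a 0).trans (Nat.le_ceil _))
  rw [Real.rpow_natCast] at hpow_a
  calc ∑ q ∈ A (m + 1), kestenCyl 2 (m + 1) q
      ≤ ∑ q ∈ A (m + 1), C * ((m + 1 : ℕ) : ℝ) ^ a * (connectiveConstant 2 ^ (m + 1))⁻¹ :=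
        Finset.sum_le_sum fun q hq => h (m + 1) hm1 q (hA (m + 1) hq)
    _ = ((A (m + 1)).card : ℝ) * (C * ((m + 1 : ℕ) : ℝ) ^ a * (connectiveConstant 2 ^ (m + 1))⁻¹) := by
        rw [Finset.sum_const, nsmul_eq_mul]
    _ ≤ |K * C| * (((m + 1 : ℕ) : ℝ) ^ N * r ^ (m + 1)) := by
        -- if `A (m+1)` is empty the left side is `0`; otherwise `C ≥ 0`
        rcases (A (m + 1)).eq_empty_or_nonempty with he | hne
        · rw [he, Finset.card_empty, Nat.cast_zero, zero_mul]
          exact mul_nonneg (abs_nonneg _) (mul_nonneg (pow_nonneg (Nat.cast_nonneg _) _) (pow_nonneg hr0.le _))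
        · obtain ⟨q, hq⟩ := hne
          have hC : 0 ≤ C * ((m + 1 : ℕ) : ℝ) ^ a * (connectiveConstant 2 ^ (m + 1))⁻¹ :=
            (kestenCyl_nonneg' _ _).trans (h (m + 1) hm1 q (hA (m + 1) hq))
          have hpos : 0 < ((m + 1 : ℕ) : ℝ) ^ a * (connectiveConstant 2 ^ (m + 1))⁻¹ :=
            mul_pos (Real.rpow_pos_of_pos (by positivity) _) (inv_pos.2 (pow_pos hμ _))
          have hC0 : 0 ≤ C := by
            by_contra hneg
            rw [not_le] at hneg
            have : C * ((m + 1 : ℕ) : ℝ) ^ a * (connectiveConstant 2 ^ (m + 1))⁻¹ < 0 := by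
              rw [mul_assoc]; exact mul_neg_of_neg_of_pos hneg hpos
            linarith
          calc ((A (m + 1)).card : ℝ) * (C * ((m + 1 : ℕ) : ℝ) ^ a * (connectiveConstant 2 ^ (m + 1))⁻¹)
              ≤ K * θ ^ (m + 1) * (C * ((m + 1 : ℕ) : ℝ) ^ a * (connectiveConstant 2 ^ (m + 1))⁻¹) :=
                mul_le_mul_of_nonneg_right (hcard (m + 1)) hC
            _ = K * C * (((m + 1 : ℕ) : ℝ) ^ a * r ^ (m + 1)) := by
                rw [hr, div_pow]; ring
            _ ≤ |K * C| * (((m + 1 : ℕ) : ℝ) ^ a * r ^ (m + 1)) :=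
                mul_le_mul_of_nonneg_right (le_abs_self _) (mul_nonneg (Real.rpow_nonneg (Nat.cast_nonneg _) _) (pow_nonneg hr0.le _))
            _ ≤ |K * C| * (((m + 1 : ℕ) : ℝ) ^ N * r ^ (m + 1)) :=
                mul_le_mul_of_nonneg_left (mul_le_mul_of_nonneg_right hpow_a (pow_nonneg hr0.le _)) (abs_nonneg _)

end Literature.Probability.RandomPlanarGeometry.SAW.Zd

end
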